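import Summits.HodgeConjecture.HodgeConjecture.Theorems.F0P6aDatumOfInputsDefs
import Literature.AlgebraicGeometry.AbelianSchemes.IdealTorsionLayerRank
import Literature.AlgebraicGeometry.AbelianSchemes.AbelianSchemeOverCommOfReduced
import Literature.NumberTheory.Automorphic.GaloisActionPlaces
import Literature.AlgebraicGeometry.GroupSchemes.KernelCoprimeTorsionRank
import Literature.AlgebraicGeometry.GroupSchemes.EtaleKernelDecidedOnPoints
import Literature.AlgebraicGeometry.AbelianSchemes.FrobeniusKernelAlongSubgroupScheme
import Literature.AlgebraicGeometry.GroupSchemes.KernelCoprimeTorsionRankSqueeze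
import Literature.AlgebraicGeometry.GroupSchemes.FrobeniusKillsQuotientEtale
import HarnessLib
import HarnessLib.Audit.LibrarySuggestionsDenyListCruxes

/-!
# `F0P6aRoofWCountsTop` — ★ RE-HOME of the crux workfile `Lines/F0_P6a_RoofWCounts.lean` (tree ED. 2 sha16 19385c8201dbcf3d, 564 l., 11 declaration commands, code-`sorry`-free), PART 1 of 2

This `Theorems/` module is the TREE BYTES of that workfile with the NAMESPACE KEPT, so every fully-qualified name is UNCHANGED; only this module docstring is re-headed,
the `Lines` imports are switched to their ★ re-homed twins — `Lines.F0_P6a_DatumOfInputs` → ★ `Theorems.F0P6aDatumOfInputsDefs` — and the audit carrier `LibrarySuggestionsDenyListCruxes` is CARRIED on this root part (bare import, LEAD «M-142d» (1) rule «P-κ»; parts 2…n inherit it transitively)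
Why a re-home: a `Theorems/` file cannot import a `Lines/` workfile (F0P6-ref1 o-6), and closing stmt-HodgeConjecture-24832 `--as proved --by <Theorems decl>` at rung 0 needs the
sorry-free `Lines` chain behind the gate (RE-HOME TABLE v1.7, LA7-plan (g7); PLAN «L3 cone RE-HOME» v1, LA3-plan (g5); LEAD F0P6-plan (g5) «M-140» (1)∕(4), 2026-09-02).
SIZE LINT (`Theorems/` files with proofs ≤ 400 l.): the workfile is cut into 2 consecutive parts `F0P6aRoofWCountsTop` → `F0P6aRoofWCounts`; this is PART 1 (tree lines :1–:382); each later part imports the previous one and re-opens the scopes open at its cut with their `variable`∕`open`∕`set_option` lines replayed verbatim; the LAST part `F0P6aRoofWCounts` is the module the `Lines/` shim and consumers import.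
After the chain is ★ the `Lines` workfile becomes a one-import SHIM of `F0P6aRoofWCounts` (a `Lines/` write, batched per cone on the LEAD՚s word), so no environment holds two copies (NO-CROSS-IMPORT).
It asserts nothing beyond what the workfile already proves.  HC_CM is proved only modulo the 7 printed citations (2 remaining: hLiu418 = stmt-HodgeConjecture-24832, h413 = stmt-HodgeConjecture-24833) until rung 0 closes; a re-home is count-neutral.

## Original module docstring (verbatim)
# (W-γ) THE TWO COUNTS ON THE `w`-SIDE AT x̄ — `hrkw_sch₀Of` («`rk Γ(A_x̄[𝔭_w]) = q²`», (γ′)) and `hrkN_sch₀Of` («`rk Γ(Ker q̄ ∩ A_x̄[𝔭_w]) = q`», (k2b′))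
# (HOME-only Lines capital, LA3-p03 (g3); LA3-plan (g2) ruling 07:38:51Z (W-γ); binders of A-p03 (g32)'s `hlaw_w_sch₀Of` f507ee09 :164–:171 VERBATIM)

`crux_decl: Summit.HodgeConjecture.HodgeConjecture.Theses.HCCMUnconditional.HLiu418`.  Cell `hodgecm-mathlib` (D-0151), «GO 500» half A line L3 (socket `stub_ROOF0` →
`stub_ROOFGEO`, W5 junction LA3-p02 (g3); GAP-2 «W-instantiation at x̄» `hlaw_w_sch₀Of`, pen A-p03 (g32), leaflet cand `Lines/F0_P6a_RoofWInstantiation.lean`).  A-p03's head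
consumes the two `w`-side counts REALISATION-FREE, as `∀ {Z} (ζ : Z ⟶ A_x̄) [Mono ζ], «points law» → finrank`; this pack proves them in exactly that shape, so that the W5
junction passes `hrkw := hrkw_sch₀Of I x̄` and `hrkN := hrkN_sch₀Of I x̄ qbar hr4 hkerq hfin hrkK hrkcw`.

* §1 (γ′) **`hrkw_sch₀Of`** — NO extra binder.  The c•w DOCK `𝔡 x̄` reads `A_x̄[𝔭_{c•w}]` (`hrkG₀`), not `A_x̄[𝔭_w]`; the `w`-layer and its rank `q²` come from ★ p849994 (γ)
  `RingAction.exists_idealTorsionLayer_finrank_eq` at `𝔴 := 𝔭_w`, fed EXACTLY as spine §4 `blockDock_of_inputs` feeds the c•w dock: ★ (O-CRT) `exists_eq_pow_mul_coprime` ∕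
  `exists_blockIdempotentFamily` at `p ∈ 𝔭_w` (`I.hpChar.2`), the height socket (S-H) ★ p846766 `hrank_specialFibre_of_isSmoothProper` at `𝔭_w` with `#(𝒪_F ⁄ 𝔭_w) = p^f`
  (`I.hfDeg` at `𝔭_{c•w}` moved by ★ `HeightOneSpectrum.card_quotient_smul`), commutativity ★ `AbelianSchemeOver.isCommMonObj_of_field`.  Then two monomorphisms with the
  same `T`-points are isomorphic over `A_x̄` (★ `exists_iso_of_fac_of_fac`) and ★ `Alg.finrank_eq_of_iso`.
* §2 (k2b′) **`hrkN_sch₀Of`** — THREE binders beyond A-p03's (`hfin : IsFinite qbar.left` (LEGS `_kerRowsFin`), `hrkK : rk Γ(Ker q̄) = q²` ((K4-fin) ∘ (ρ2‴)),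
  `hrkcw` = the c•w twin row realisation-free (W2 §3a `finrank_alg_eq_of_kernelReading`)): ★ `IdealTorsionCoprimeSplitting.finrank_alg_ker_eq_mul` (LA3-p03, ★
  `GroupSchemes/KernelCoprimeTorsionRank`, over ★ p849988) at `q := q̄`, `ι := ι_x̄` (Defs `act₀Of`), `(𝔞, 𝔟) := (𝔭_{c•w}, 𝔭_w)` (coprime as `c•w ≠ w`), the restricted
  action on `Ker q̄` built by `kerLift` (`Ker q̄` is `ι`-stable from the WEAK (r4₀-q) `hr4`, ★ `comp_comp_eq_one_of_exists_comp_eq`), `hkerq` as the killing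
  clause; it yields `q² = q · rk Γ(Z)`, whence `rk Γ(Z) = q`.

HOME-only (imports the D-LINE for the frame `RGDInputsAt` ∕ Defs; neither theorem needs the dock `𝔡` or `[ExpChar]`); namespace `…Cruxes.HLiu418.F0P6aRoofWCounts`.  THEOREMS ONLY, sorry-free, no instance ∕ notation.  Seams: Defs `sch₀Of 𝓜 w I.univ x̄ =
(I.univ.baseChange ι_s).baseChange x̄.left` and `(act₀Of 𝓜 w I.univ I.act a x̄).hom.hom.hom = ((I.act.baseChange ι_s).baseChange x̄.left).i a` are `rfl` (A-p03 (g31) §0b).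
HC_CM is proved only modulo the 7 printed citations (2 remaining: hLiu418 = stmt-HodgeConjecture-24832, h413 = stmt-HodgeConjecture-24833) until rung 0 closes; count-neutral.

## References
* [Tate1967] J. Tate, *p-divisible groups* (1967), §2 (2.2), (2.4).
* [Tate1997FiniteFlatGroupSchemes] J. Tate, *Finite flat group schemes* (1997), (3.7).
* [RapoportSmithlingZhang2020Diagonal] M. Rapoport, B. Smithling, W. Zhang, *Arithmetic diagonal cycles on unitary Shimura varieties* (2020), §4.1 (p. 17).
* [Liu2021] Y. Liu, *Fourier–Jacobi cycles and arithmetic relative trace formula* (2021), Appendix D (pp. 136–137).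
-/

set_option autoImplicit false
set_option linter.dupNamespace false

-- Mathlib's `Over`/`Scheme` APIs and the Defs wrappers are stated across semireducible wrappers.
set_option backward.isDefEq.respectTransparency false

noncomputable section

namespace Summit.HodgeConjecture.HodgeConjecture.Cruxes.HLiu418.F0P6aRoofWCounts

open CategoryTheory CategoryTheory.Limits AlgebraicGeometry NumberField IsDedekindDomain MulAction
open MonoidalCategory CartesianMonoidalCategory
open scoped Matrix Pointwise MonObj CategoryTheory.Obj
open Literature.NumberTheory.GaloisRepresentations
open Literature.NumberTheory.Automorphic Literature.NumberTheory.Automorphic.UnitaryGroup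
open Literature.AlgebraicGeometry.ShimuraVarieties.UnitaryCanonicalModel
open Literature.NumberTheory.Automorphic.Liu2021.AppendixC
open Literature.AlgebraicGeometry.Motives (AlgPoints IntegralModel SchemeOver thickening thickeningLift specOver relFrobeniusOver frobeniusTwistOver frobSpec)
open Literature.NumberTheory.DiophantineGeometry (geomResidueField specResidueField)
open Literature.AlgebraicGeometry.RelativeSpec (ActionOver)
open Literature.AlgebraicGeometry.GroupSchemes
open Literature.AlgebraicGeometry.GroupSchemes.AffineGroupScheme (Alg quotIncl)
open Literature.AlgebraicGeometry.GroupSchemes.GroupSchemeKernel (ker kerι kerLift kerLift_ι kerι_comp isMonHom_kerLift)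
open Literature.AlgebraicGeometry.AbelianSchemes Literature.AlgebraicGeometry.AbelianSchemes.AbelianSchemeOver
open Literature.AlgebraicGeometry.AbelianSchemes.AbelianSchemeOver.RingAction
open Literature.AlgebraicGeometry.GroupSchemes.BTGroup Literature.AlgebraicGeometry.GroupSchemes.BTGroup.Hom
open Literature.AlgebraicGeometry.GroupSchemes.IsRingActionBT
open Literature.AlgebraicGeometry.HodgeTheory Literature.AlgebraicGeometry.HodgeTheory.RingAction
open Literature.RingTheory.DedekindDomain
open Summit.HodgeConjecture.HodgeConjecture.Cruxes.HLiu418.F0P6aModuliDatumDefs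
open Summit.HodgeConjecture.HodgeConjecture.Cruxes.HLiu418.F0P6aRGDAssembly
open Summit.HodgeConjecture.HodgeConjecture.Cruxes.HLiu418.F0P6aDatumOfInputs

variable {F : Type} [Field F] [NumberField F] [IsCMField F] [IsGalois ℚ F] {ι₁ : F →+* ℂ}
    {Jstar : Matrix (Fin 2) (Fin 2) F}
    {K₀ : C5.OpenCompactSubgroup ↥(finAdelic ↥(maximalRealSubfield F) F (IsCMField.complexConj F) 2 Jstar)}
    {S : RecordSystemGS F Jstar ι₁ K₀} {hU7ₛ : S.HeckeTranslateDefinedOver}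
    {hJ : (Jstar.map (IsCMField.complexConj F))ᵀ = Jstar} {hJu : IsUnit Jstar}
    {Fi : Type} [Field Fi] [Algebra F Fi] {Kc : C5.SmallLevel K₀} {G : Type} [Group G]
    {𝓜 : IntegralModel (𝓞 F) F ((thickening F Fi).obj (S.M.obj Kc))}
    {w : HeightOneSpectrum (𝓞 F)} {hw : (IsCMField.complexConj F) • w ≠ w} {h𝓨 : (𝓜.localise w).IsSmoothProper 1}
    {θ : ActionOver (𝓜.localise w).total.hom ((Fi ≃ₐ[F] Fi) × G)}
    {e : Fi →ₐ[F] AlgebraicClosure (w.adicCompletion F)}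

variable (I : RGDInputsAt F ι₁ Jstar K₀ S hU7ₛ hJ hJu Fi Kc G 𝓜 w hw h𝓨 θ e)

/-! ## §1 (γ′) `rk Γ(Z) = q²` for every monomorphism `ζ : Z ↪ A_x̄` reading the `𝔭_w`-torsion -/

/-- **§1 (γ′) `hrkw_sch₀Of`** — the binder `hrkw` of `hlaw_w_sch₀Of` VERBATIM: for every monomorphism `ζ : Z ↪ A_x̄` whose `T`-points are, for every `T`, exactly the points of
`A_x̄` killed by `ι(r)`, `r ∈ 𝔭_w`, one has `dim_κ̄ Γ(Z) = q · q` (`q = p^f`).  PROOF: ★ p849994 (γ) `exists_idealTorsionLayer_finrank_eq` at `𝔴 := 𝔭_w` (block data ★ (O-CRT),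
height socket (S-H) ★ `hrank_specialFibre_of_isSmoothProper` at `𝔭_w`, `#(𝒪_F ⁄ 𝔭_w) = #(𝒪_F ⁄ 𝔭_{c•w}) = p^f` by ★ `HeightOneSpectrum.card_quotient_smul` and `I.hfDeg`) gives a closed
subgroup `ιA : G ↪ A_x̄` with the same points law and `rk Γ(G) = q²`; two monomorphisms with the same points are isomorphic over `A_x̄` (★ `exists_iso_of_fac_of_fac`), and
`Γ` ranks agree (★ `Alg.finrank_eq_of_iso`). [cite: Tate1967, §2 (2.2), (2.4)] [cite: Tate1997FiniteFlatGroupSchemes, (3.7)] [cite: RapoportSmithlingZhang2020Diagonal, §4.1 (p. 17)]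
[cite: Liu2021, Appendix D (p. 136)] -/
theorem hrkw_sch₀Of (xbar : AlgPoints (𝓜.localise w).reductionAt (geomResidueField w)) :
    ∀ {Z : SchemeOver (geomResidueField w)} (ζ : Z ⟶ (sch₀Of 𝓜 w I.univ xbar).X) [Mono ζ],
      (∀ ⦃T : SchemeOver (geomResidueField w)⦄ (x : T ⟶ (sch₀Of 𝓜 w I.univ xbar).X),
        (∃ z : T ⟶ Z, z ≫ ζ = x) ↔ ∀ r ∈ w.asIdeal, x ≫ (act₀Of 𝓜 w I.univ I.act r xbar).hom.hom.hom = 1) →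
      Module.finrank (geomResidueField w) (Alg Z) = I.pChar ^ I.fDeg * I.pChar ^ I.fDeg := by
  intro Z ζ _ hZ
  classical
  haveI : Fact I.pChar.Prime := ⟨I.hpChar.1⟩
  haveI : w.asIdeal.IsMaximal := w.isMaximal
  haveI : IsCommMonObj I.univ.X := I.comm
  haveI : IsCommMonObj (sch₀Of 𝓜 w I.univ xbar).X := AbelianSchemeOver.isCommMonObj_of_field _
  -- (O-CRT) block data at `𝔴 := 𝔭_w`
  have hw0 : w.asIdeal ≠ ⊥ := w.ne_bot
  have hp0 : ((I.pChar : ℕ) : 𝓞 F) ≠ 0 := Nat.cast_ne_zero.2 I.hpChar.1.ne_zero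
  obtain ⟨e', 𝔟, he, hx, hcop⟩ := exists_eq_pow_mul_coprime w.isPrime hw0 hp0 I.hpChar.2
  obtain ⟨a, ha1, ha2⟩ := exists_blockIdempotentFamily hcop e'
  -- relative dimension `[F:ℚ]`, residue cardinality `p^f` at `𝔭_w` (from `𝔭_{c•w}`)
  have hgF : I.univ.IsOfRelDim (Module.finrank ℚ F) := I.hg ▸ I.relDim
  have hf : Nat.card (𝓞 F ⧸ w.asIdeal) = I.pChar ^ I.fDeg := by
    rw [← HeightOneSpectrum.card_quotient_smul (IsCMField.complexConj F) w]; exact I.hfDeg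
  -- ★ p849994 (γ) at `𝔭_w`, the (S-H) socket by ★ p846766
  obtain ⟨Gw, _grp, _comm, _aff, _fin, ιA, βG, ⟨-, hci⟩, hkerA, -, -, hrk⟩ :=
    exists_idealTorsionLayer_finrank_eq (A := sch₀Of 𝓜 w I.univ xbar) I.pChar I.fDeg
      ((hgF.baseChange (pullback.fst (𝓜.localise w).total.hom (specResidueField w))).baseChange
        (xbar.left : Spec (.of (geomResidueField w)) ⟶ pullback (𝓜.localise w).total.hom (specResidueField w)))
      ((I.act.baseChange (pullback.fst (𝓜.localise w).total.hom (specResidueField w))).baseChange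
        (xbar.left : Spec (.of (geomResidueField w)) ⟶ pullback (𝓜.localise w).total.hom (specResidueField w)))
      w.asIdeal hw0 I.hpChar.2 he hx hcop a ha1 ha2
      (fun n s' => hrank_specialFibre_of_isSmoothProper (𝓜.localise w) h𝓨 hgF I.act (Fact.out : I.pChar.Prime).ne_zero
        w.asIdeal hw0 hf hx hcop a ha1 ha2 xbar n s')
  -- `Gw ↪ A_x̄` and `ζ` read the same points
  haveI : IsClosedImmersion ιA.left := hci
  haveI : Mono ιA := Over.mono_of_mono_left _
  have hpts : ∀ ⦃T : SchemeOver (geomResidueField w)⦄ (x : T ⟶ (sch₀Of 𝓜 w I.univ xbar).X),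
      (∃ z : T ⟶ Z, z ≫ ζ = x) ↔ ∃ s : T ⟶ Gw, s ≫ ιA = x := fun T x => (hZ x).trans (hkerA x)
  obtain ⟨u, hu⟩ := (hpts ζ).1 ⟨𝟙 Z, Category.id_comp ζ⟩
  obtain ⟨v, hv⟩ := (hpts ιA).2 ⟨𝟙 Gw, Category.id_comp ιA⟩
  obtain ⟨eZ, -, -⟩ := exists_iso_of_fac_of_fac ζ ιA u hu v hv
  rw [Alg.finrank_eq_of_iso eZ]
  exact hrk

/-! ## §2 (k2b′) `rk Γ(Z) = q` for every monomorphism `ζ : Z ↪ A_x̄` reading «`𝔭_w`-torsion ∧ killed by `q̄`» -/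

section KernelCount

open Literature.AlgebraicGeometry.GroupSchemes.IdealTorsionCoprimeSplitting (comp_comp_eq_one_of_exists_comp_eq finrank_alg_ker_eq_mul)

set_option maxHeartbeats 400000 in -- rung-E fix-forward (f0), LEAD «M-136a»: K4-shim environment pushes whnf past the default 200 000; statement∕proof bytes unchanged
/-- **§2 (k2b′) `hrkN_sch₀Of`** — conclusion = the binder `hrkN` of `hlaw_w_sch₀Of` VERBATIM: for every monomorphism `ζ : Z ↪ A_x̄` whose `T`-points are exactly the points
`x` with `x ≫ ι(r) = 1` (`r ∈ 𝔭_w`) and `x ≫ q̄ = 1`, `dim_κ̄ Γ(Z) = q`.  INPUTS beyond A-p03's binders `qbar hr4 hkerq`: `hfin` (`q̄.left` finite — LEGS `_kerRowsFin`),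
`hrkK` (`dim Γ(Ker q̄) = q²` — (K4-fin) transport ∘ (ρ2‴) upstairs count), `hrkcw` (every monomorphism reading «`𝔭_{c•w}`-torsion ∧ `q̄`-killed» has rank `q` — W2 §3a
`finrank_alg_eq_of_kernelReading I 𝔡 x̄ qbar hdock`).  PROOF: `Ker q̄` is finite, affine, with `Γ` finite (`hfin`, ★ `isFinite_ker_hom_of_isFinite`; `hrkK ≠ 0`); it is
`ι`-stable by the weak equivariance `hr4` (★ `comp_comp_eq_one_of_exists_comp_eq`), so `ι` restricts along `ι_{Ker q̄}` (`kerLift`); `𝔭_{c•w} + 𝔭_w = (1)` (`c•w ≠ w`);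
`𝔭_w 𝔭_{c•w}` kills `Ker q̄` (`hkerq`); ★ `finrank_alg_ker_eq_mul` gives `q² = q · dim Γ(Z)`.  The dock `𝔡` enters only through the consumer's `hrkcw`.
[cite: Tate1997FiniteFlatGroupSchemes, (3.7)] [cite: Tate1967, §2 (2.2)] [cite: Liu2021, Appendix D (p. 137)] -/
theorem hrkN_sch₀Of (xbar : AlgPoints (𝓜.localise w).reductionAt (geomResidueField w))
    {Bbar : AbelianSchemeOver (Spec (.of (geomResidueField w)))} (qbar : (sch₀Of 𝓜 w I.univ xbar).X ⟶ Bbar.X) [IsMonHom qbar]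
    (hr4 : ∀ a : 𝓞 F, ∃ b : Bbar.X ⟶ Bbar.X, (act₀Of 𝓜 w I.univ I.act a xbar).hom.hom.hom ≫ qbar = qbar ≫ b)
    (hkerq : ∀ ⦃T : SchemeOver (geomResidueField w)⦄ (z : T ⟶ (sch₀Of 𝓜 w I.univ xbar).X), z ≫ qbar = 1 →
      ∀ b ∈ w.asIdeal * ((IsCMField.complexConj F) • w).asIdeal, z ≫ (act₀Of 𝓜 w I.univ I.act b xbar).hom.hom.hom = 1)
    (hfin : IsFinite qbar.left)
    (hrkK : Module.finrank (geomResidueField w) (Alg (ker qbar)) = I.pChar ^ I.fDeg * I.pChar ^ I.fDeg)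
    (hrkcw : ∀ {Z' : SchemeOver (geomResidueField w)} (ζ' : Z' ⟶ (sch₀Of 𝓜 w I.univ xbar).X) [Mono ζ'],
      (∀ ⦃T : SchemeOver (geomResidueField w)⦄ (x : T ⟶ (sch₀Of 𝓜 w I.univ xbar).X),
        (∃ z : T ⟶ Z', z ≫ ζ' = x) ↔
          (∀ r ∈ ((IsCMField.complexConj F) • w).asIdeal, x ≫ (act₀Of 𝓜 w I.univ I.act r xbar).hom.hom.hom = 1) ∧ x ≫ qbar = 1) →
      Module.finrank (geomResidueField w) (Alg Z') = I.pChar ^ I.fDeg) :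
    ∀ {Z : SchemeOver (geomResidueField w)} (ζ : Z ⟶ (sch₀Of 𝓜 w I.univ xbar).X) [Mono ζ],
      (∀ ⦃T : SchemeOver (geomResidueField w)⦄ (x : T ⟶ (sch₀Of 𝓜 w I.univ xbar).X),
        (∃ z : T ⟶ Z, z ≫ ζ = x) ↔ (∀ r ∈ w.asIdeal, x ≫ (act₀Of 𝓜 w I.univ I.act r xbar).hom.hom.hom = 1) ∧ x ≫ qbar = 1) →
      Module.finrank (geomResidueField w) (Alg Z) = I.pChar ^ I.fDeg := by
  intro Z ζ _ hZ
  have hq0 : I.pChar ^ I.fDeg ≠ 0 := pow_ne_zero _ I.hpChar.1.ne_zero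
  -- `Ker q̄`: finite over `κ̄`, affine, `Γ` finite
  haveI : IsFinite qbar.left := hfin
  haveI : IsFinite (ker qbar).hom := AbelianSchemeOver.isFinite_ker_hom_of_isFinite qbar
  haveI : IsAffine (ker qbar).left := isAffine_of_isAffineHom (ker qbar).hom
  haveI : Module.Finite (geomResidueField w) (Alg (ker qbar)) :=
    Module.finite_of_finrank_pos (by rw [hrkK]; exact Nat.pos_of_ne_zero (mul_ne_zero hq0 hq0))
  -- ★ K6 RE-HOME SPEED EDIT (LA3-p03 (g7) 2026-09-02, LEAD «M-142b» (2); statement bytes unchanged): ONE SYNTACTIC FORM OF THE SPECIAL FIBRE.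
  -- `(act₀Of …).hom.hom.hom` is typed on `((A'.fibre x̄).toAbelianVariety).X` (★ `fibreHom`), the binders `x`, `ζ`, `q̄`, `Ker q̄` on `(sch₀Of …).X =
  -- (A'.baseChange x̄).X`; the two group structures agree only by unfolding `toAbelianVariety`∕`fibre`∕`toAffine`, and every instance argument unified
  -- ACROSS the two spellings cost ≈ 2 min of `isDefEq` (547 s of typeclass inference in this one proof, gate lane 600 s).  Cure: read the four
  -- hypotheses through the ★ `rfl`-lemmas once (`dsimp only`, definitional), then run the plumbing on the raw base-changed action `ρx̄.i`
  -- (★ `RingAction.baseChange`), whose homomorphism∕unit∕sum∕product laws are FIELDS — nothing is coerced across the two spellings any more.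
  dsimp only [act₀Of, AbelianSchemeOver.fibreHom_hom_hom_hom, AbelianScheme.toAbelianVariety_X, AbelianScheme.toAbelianVariety_grpObj,
    AbelianSchemeOver.fibre, AbelianSchemeOver.toAffine_X, AbelianSchemeOver.toAffine_grpObj] at hr4 hkerq hrkcw hZ
  let ρx := (I.act.baseChange (pullback.fst (𝓜.localise w).total.hom (specResidueField w))).baseChange xbar.left
  haveI hmon : ∀ a : 𝓞 F, IsMonHom (ρx.i a) := ρx.isMonHom
  -- `Ker q̄` is `ι`-stable (weak (r4₀-q)); the restricted action along `ι_{Ker q̄}`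
  have hstab : ∀ (a : 𝓞 F) ⦃T : SchemeOver (geomResidueField w)⦄ (x : T ⟶ (sch₀Of 𝓜 w I.univ xbar).X), x ≫ qbar = 1 →
      (x ≫ ρx.i a) ≫ qbar = 1 := fun a T x hx => comp_comp_eq_one_of_exists_comp_eq ρx.i qbar (hr4 a) x hx
  haveI : ∀ a : 𝓞 F, IsMonHom (kerLift (f := qbar) (kerι qbar ≫ ρx.i a) (hstab a (kerι qbar) (kerι_comp qbar))) :=
    fun a => isMonHom_kerLift _ _
  -- `𝔭_{c•w} + 𝔭_w = (1)` and `𝔭_{c•w} 𝔭_w` kills `Ker q̄`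
  have hcop : ((IsCMField.complexConj F) • w).asIdeal ⊔ w.asIdeal = ⊤ :=
    Ideal.IsMaximal.coprime_of_ne ((IsCMField.complexConj F) • w).isMaximal w.isMaximal fun h => hw (HeightOneSpectrum.ext h)
  have hkq : ∀ ⦃T : SchemeOver (geomResidueField w)⦄ (x : T ⟶ (sch₀Of 𝓜 w I.univ xbar).X), x ≫ qbar = 1 →
      ∀ c ∈ ((IsCMField.complexConj F) • w).asIdeal * w.asIdeal, x ≫ ρx.i c = 1 :=
    fun T x hx c hc => hkerq x hx c (by rwa [mul_comm] at hc)
  -- ★ the coprime splitting of `rk Γ(Ker q̄)` with realisation-free factors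
  have h := finrank_alg_ker_eq_mul ρx.i qbar (fun a => kerLift (kerι qbar ≫ ρx.i a) (hstab a (kerι qbar) (kerι_comp qbar)))
    (fun a => kerLift_ι _ _) ρx.i_one ρx.i_add ρx.i_mul hcop hkq (m := I.pChar ^ I.fDeg) hrkcw ζ hZ
  rw [hrkK] at h
  exact (mul_left_cancel₀ hq0 h).symm

end KernelCount

/-! ## §3 (k2b-dock) The dock seam: a `c•w`-side count at `A_x̄` IS a count of kernel readings inside the dock `G₀(x̄)` -/

section DockSeam

variable [ExpChar (geomResidueField w) I.pChar]

/-- **§3 (k2b-dock) `finrank_dockReading_eq_of_cwReading`** — THE POINTS SEAM THROUGH THE DOCK ROWS (hdock-free, realisation-free on both sides).  For ANY morphism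
`ψ : A_x̄ → Y` and ANY number `n`: if every monomorphism `ζ' : Z' ↪ A_x̄` reading «`𝔭_{c•w}`-torsion ∧ `ψ`-killed» has `dim_κ̄ Γ(Z') = n` (the shape of the transport row
(RK₀-𝔞) at `𝔞 := 𝔭_{c•w}`, LA1-p03 (g3) ★ (K4-𝔞), fed with the upstairs count), then every monomorphism `ζ : Z ↪ G₀(x̄)` INTO THE DOCK reading «`t ≫ ι₀G ≫ ψ = 1`» has
`dim_κ̄ Γ(Z) = n` — because `ζ ≫ ι₀G : Z ↪ A_x̄` is a monomorphism (dock row `hι₀G`: `ι₀G` a closed immersion) reading «`𝔭_{c•w}`-torsion ∧ `ψ`-killed» (dock row `hkerG₀`: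
the points of `G₀(x̄)` are exactly the `𝔭_{c•w}`-torsion points; Defs `act₀Of` = the dock's raw action, `rfl`).  This is the (k2b) input of (ρ1𝒞) §B (LA1-p01 (g3)) in its
binder currency, at `ψ :=` the reduced leg and `n := q`. [cite: Tate1997FiniteFlatGroupSchemes, (3.7)] [cite: Liu2021, Appendix D (p. 137)] -/
theorem finrank_dockReading_eq_of_cwReading (𝔡 : ∀ xbar, DockAt I xbar) (xbar : AlgPoints (𝓜.localise w).reductionAt (geomResidueField w))
    {Y : SchemeOver (geomResidueField w)} [GrpObj Y] (ψ : (sch₀Of 𝓜 w I.univ xbar).X ⟶ Y) {n : ℕ}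
    (hRK : ∀ {Z' : SchemeOver (geomResidueField w)} (ζ' : Z' ⟶ (sch₀Of 𝓜 w I.univ xbar).X) [Mono ζ'],
      (∀ ⦃T : SchemeOver (geomResidueField w)⦄ (x : T ⟶ (sch₀Of 𝓜 w I.univ xbar).X),
        (∃ z : T ⟶ Z', z ≫ ζ' = x) ↔
          (∀ r ∈ ((IsCMField.complexConj F) • w).asIdeal, x ≫ (act₀Of 𝓜 w I.univ I.act r xbar).hom.hom.hom = 1) ∧ x ≫ ψ = 1) →
      Module.finrank (geomResidueField w) (Alg Z') = n) :
    ∀ {Z : SchemeOver (geomResidueField w)} (ζ : Z ⟶ (𝔡 xbar).G₀) [Mono ζ],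
      (∀ ⦃T : SchemeOver (geomResidueField w)⦄ (t : T ⟶ (𝔡 xbar).G₀), (∃ z : T ⟶ Z, z ≫ ζ = t) ↔ t ≫ (𝔡 xbar).ι₀G ≫ ψ = 1) →
      Module.finrank (geomResidueField w) (Alg Z) = n := by
  intro Z ζ _ hZ
  haveI : IsClosedImmersion (𝔡 xbar).ι₀G.left := (𝔡 xbar).hι₀G.2
  haveI : Mono (𝔡 xbar).ι₀G := Over.mono_of_mono_left _
  haveI : Mono (ζ ≫ (𝔡 xbar).ι₀G) := mono_comp _ _
  refine hRK (ζ ≫ (𝔡 xbar).ι₀G) fun T x => ⟨?_, ?_⟩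
  · rintro ⟨z, rfl⟩
    refine ⟨?_, by simpa only [Category.assoc] using (hZ (z ≫ ζ)).1 ⟨z, rfl⟩⟩
    -- the points of `G₀(x̄)` are `𝔭_{c•w}`-torsion (dock row `hkerG₀`; `act₀Of` = raw action, `rfl`)
    exact ((𝔡 xbar).hkerG₀ (z ≫ ζ ≫ (𝔡 xbar).ι₀G)).2 ⟨z ≫ ζ, by simp only [Category.assoc]⟩
  · rintro ⟨hcw, hψ⟩
    obtain ⟨t, ht⟩ := ((𝔡 xbar).hkerG₀ x).1 hcw
    obtain ⟨z, hz⟩ := (hZ t).2 (by rw [← Category.assoc, ht, hψ])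
    exact ⟨z, by rw [← Category.assoc, hz, ht]⟩

end DockSeam

/-! ## §4 (k2b-count) The upstairs number: a roof kernel meets the `𝔭_{c•w}`-torsion in exactly `q` points -/

section Count

/-- **§4 (k2b-count) `natCard_inter_cwTorsion_eq_of_line`** — for a line `L` at `y` (`LineOf I y`: an `𝒪_F`-stable subgroup of `A_y(Ω̄)` of order `q = p^f` killed by `𝔭_{c•w}`) and
any subgroup `K ⊆ A_y(Ω̄)` meeting the `𝔭_{c•w}`-torsion exactly in `L` (the first clause of `RoofLink I quotΩ`), the set «`P ∈ K` ∧ `P` is `𝔭_{c•w}`-torsion» has EXACTLY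
`p^f` elements (`L.2.1`).  The UPSTAIRS COUNT fed into the transport row (RK₀-𝔞) at `𝔞 := 𝔭_{c•w}` (LA1-p03 (g3) ★ (K4-𝔞)); hdock-free. [cite: Liu2021, Prop. D.8 p. 135]
[cite: HarrisTaylorAMS2001, §III.4, pp. 108–110] -/
theorem natCard_inter_cwTorsion_eq_of_line (y : AlgPoints (S.M.obj Kc) (AlgebraicClosure (w.adicCompletion F))) (L : LineOf I y)
    (K : Subgroup ((fibreΩOf S Kc 𝓜 w e I.univ y).Points (AlgebraicClosure (w.adicCompletion F))))
    (hLK : ∀ P, P ∈ L.1 ↔ P ∈ K ∧ IsIdealTorsionΩ S Kc 𝓜 w e I.univ I.act y ((IsCMField.complexConj F) • w).asIdeal P) :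
    Nat.card {P : (fibreΩOf S Kc 𝓜 w e I.univ y).Points (AlgebraicClosure (w.adicCompletion F)) //
      P ∈ K ∧ IsIdealTorsionΩ S Kc 𝓜 w e I.univ I.act y ((IsCMField.complexConj F) • w).asIdeal P} = I.pChar ^ I.fDeg := by
  rw [← L.2.1]
  exact Nat.card_congr (Equiv.subtypeEquivRight fun P => (hLK P).symm)

end Count

/-! ## §5 (hF) The dock Frobenius law at x̄ (= HOME pack `F0P6aRoofCwKernelHF` v1 06bf05a0, by copy; LA3-plan (g2) 08:16:23Z: one leaflet for all LA3-p03 rows) -/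

section DockFrobenius

variable [ExpChar (geomResidueField w) I.pChar]

set_option backward.isDefEq.respectTransparency false in
/-- **§5 (hF) THE DOCK FROBENIUS LAW `hF_sch₀Of`** — the binder `hF` of `hlaw_cw_of_dockClauses` (W2) ∕ `hlaw_w_sch₀Of` (GAP-2) VERBATIM: for every `T`-point `t` of the dock layer
`G₀ x̄`, `t ≫ ι₀G ≫ F_q(A_x̄) = 1 ↔ ∃ s, s ≫ quotIncl (G₀ x̄) (kerFOf I 𝔡 x̄).1 = t` — ONE `exact` (5·10⁴ heartbeats) of ★ `subgroup_comp_relFrobeniusOver_eq_one_iff_exists_comp_quotIncl`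
(★ p850282, the generic (hF) ★ p850091 stated once at a variable `A` in the spine's base-change currency; the Frobenius kernel of `A_x̄` along the homomorphic closed immersion
`ι₀G`, read in the ideal currency `kerFI p f G₀ = ker Γ(kerι F_{G₀})` by `rfl`). [cite: SGA3I, VII_A 4.1] [cite: Waterhouse1979, §2.1] [cite: Liu2021, Prop. D.8 (3) p. 137] -/
theorem hF_sch₀Of (𝔡 : ∀ xbar, DockAt I xbar) (xbar : AlgPoints (𝓜.localise w).reductionAt (geomResidueField w))
    ⦃T : SchemeOver (geomResidueField w)⦄ (t : T ⟶ (𝔡 xbar).G₀) :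
    t ≫ (𝔡 xbar).ι₀G ≫ relFrobeniusOver I.pChar I.fDeg (sch₀Of 𝓜 w I.univ xbar).X =
        (1 : T ⟶ ((sch₀Of 𝓜 w I.univ xbar).baseChange (frobSpec (geomResidueField w) I.pChar I.fDeg)).X) ↔
      haveI := (𝔡 xbar).aff₀
      ∃ s, s ≫ quotIncl (𝔡 xbar).G₀ (kerFOf I 𝔡 xbar).1 = t := by
  letI := (𝔡 xbar).grp₀
  haveI := (𝔡 xbar).aff₀
  haveI := (𝔡 xbar).fin₀
  haveI : IsMonHom (𝔡 xbar).ι₀G := (𝔡 xbar).hι₀G.1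
  haveI : IsClosedImmersion (𝔡 xbar).ι₀G.left := (𝔡 xbar).hι₀G.2
  exact subgroup_comp_relFrobeniusOver_eq_one_iff_exists_comp_quotIncl I.pChar I.fDeg (sch₀Of 𝓜 w I.univ xbar) (𝔡 xbar).ι₀G t

end DockFrobenius


/-! ## §6 (SQ at x̄) THE SQUEEZE AT THE DOCK: both realisation-free counts (k2b) ∕ (k2b′) from `rk Γ(Ker q̄) = q²`, (KILL) and the `w`-side witness (CL-w)
(★ p850561 `IdealTorsionCoprimeSplitting.finrank_alg_eq_of_squeeze` ∕ `…_squeeze'`; LA3-plan (g2) ruling 08:18:46Z road (T-w); LA3-p03 (g4)) -/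

section Squeeze

open Literature.AlgebraicGeometry.GroupSchemes.IdealTorsionCoprimeSplitting (comp_comp_eq_one_of_exists_comp_eq finrank_alg_eq_of_squeeze finrank_alg_eq_of_squeeze')

set_option maxHeartbeats 400000 in -- rung-E fix-forward (f0), LEAD «M-136a»: K4-shim environment pushes whnf past the default 200 000; statement∕proof bytes unchanged
/-- **§6 core `finrank_readings_of_squeeze_sch₀Of`** — THE SQUEEZE AT `x̄` (no dock): `q̄ : A_x̄ → B̄` a homomorphism weakly `𝒪_F`-equivariant (`hr4`), `Ker q̄` killed by `𝔭_w 𝔭_{c•w}`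
(`hkerq`), `q̄.left` finite (`hfin`), `dim Γ(Ker q̄) = q · q` (`hrkK`, `q = p^f`); a CLOSED `ν_{c•w} : V_{c•w} ↪ A_x̄` whose points are `𝔭_{c•w}`-torsion and `q̄`-killed with
`q ≤ dim Γ(V_{c•w})`, and a CLOSED `ν_w : V_w ↪ A_x̄` whose points are `𝔭_w`-torsion and `q̄`-killed with `q ≤ dim Γ(V_w)` ⟹ EVERY monomorphism `ζ' : Z' ↪ A_x̄` reading
«`𝔭_{c•w}`-torsion ∧ `q̄`-killed» has `dim_κ̄ Γ(Z') = q` AND every monomorphism `ζ : Z ↪ A_x̄` reading «`𝔭_w`-torsion ∧ `q̄`-killed» has `dim_κ̄ Γ(Z) = q`.  PROOF: §2's plumbing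
(the action `ι_x̄` by value, `Ker q̄` `ι`-stable by ★ `comp_comp_eq_one_of_exists_comp_eq`, restricted action by `kerLift`, `𝔭_{c•w} + 𝔭_w = (1)`), then ★ p850561 at
`𝔞 := 𝔭_{c•w}`, `𝔟 := 𝔭_w`, `m = n = q`. [cite: Tate1997FiniteFlatGroupSchemes, §(3.7) (p. 146)] [cite: Tate1967, §2.2] [cite: Liu2021, Appendix D, Prop. D.8 (3) (p. 137)] -/
theorem finrank_readings_of_squeeze_sch₀Of (xbar : AlgPoints (𝓜.localise w).reductionAt (geomResidueField w))
    {Bbar : AbelianSchemeOver (Spec (.of (geomResidueField w)))} (qbar : (sch₀Of 𝓜 w I.univ xbar).X ⟶ Bbar.X) [IsMonHom qbar]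
    (hr4 : ∀ a : 𝓞 F, ∃ b : Bbar.X ⟶ Bbar.X, (act₀Of 𝓜 w I.univ I.act a xbar).hom.hom.hom ≫ qbar = qbar ≫ b)
    (hkerq : ∀ ⦃T : SchemeOver (geomResidueField w)⦄ (z : T ⟶ (sch₀Of 𝓜 w I.univ xbar).X), z ≫ qbar = 1 →
      ∀ b ∈ w.asIdeal * ((IsCMField.complexConj F) • w).asIdeal, z ≫ (act₀Of 𝓜 w I.univ I.act b xbar).hom.hom.hom = 1)
    (hfin : IsFinite qbar.left)
    (hrkK : Module.finrank (geomResidueField w) (Alg (ker qbar)) = I.pChar ^ I.fDeg * I.pChar ^ I.fDeg)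
    {Vcw : SchemeOver (geomResidueField w)} (νcw : Vcw ⟶ (sch₀Of 𝓜 w I.univ xbar).X) (hνcw : IsClosedImmersion νcw.left)
    (hVcw : ∀ ⦃T : SchemeOver (geomResidueField w)⦄ (x : T ⟶ (sch₀Of 𝓜 w I.univ xbar).X), (∃ s : T ⟶ Vcw, s ≫ νcw = x) →
      (∀ r ∈ ((IsCMField.complexConj F) • w).asIdeal, x ≫ (act₀Of 𝓜 w I.univ I.act r xbar).hom.hom.hom = 1) ∧ x ≫ qbar = 1)
    (hqcw : I.pChar ^ I.fDeg ≤ Module.finrank (geomResidueField w) (Alg Vcw))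
    {Vw : SchemeOver (geomResidueField w)} (νw : Vw ⟶ (sch₀Of 𝓜 w I.univ xbar).X) (hνw : IsClosedImmersion νw.left)
    (hVw : ∀ ⦃T : SchemeOver (geomResidueField w)⦄ (x : T ⟶ (sch₀Of 𝓜 w I.univ xbar).X), (∃ s : T ⟶ Vw, s ≫ νw = x) →
      (∀ r ∈ w.asIdeal, x ≫ (act₀Of 𝓜 w I.univ I.act r xbar).hom.hom.hom = 1) ∧ x ≫ qbar = 1)
    (hqw : I.pChar ^ I.fDeg ≤ Module.finrank (geomResidueField w) (Alg Vw)) :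
    (∀ {Z' : SchemeOver (geomResidueField w)} (ζ' : Z' ⟶ (sch₀Of 𝓜 w I.univ xbar).X) [Mono ζ'],
      (∀ ⦃T : SchemeOver (geomResidueField w)⦄ (x : T ⟶ (sch₀Of 𝓜 w I.univ xbar).X),
        (∃ z : T ⟶ Z', z ≫ ζ' = x) ↔
          (∀ r ∈ ((IsCMField.complexConj F) • w).asIdeal, x ≫ (act₀Of 𝓜 w I.univ I.act r xbar).hom.hom.hom = 1) ∧ x ≫ qbar = 1) →
      Module.finrank (geomResidueField w) (Alg Z') = I.pChar ^ I.fDeg) ∧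
    (∀ {Z : SchemeOver (geomResidueField w)} (ζ : Z ⟶ (sch₀Of 𝓜 w I.univ xbar).X) [Mono ζ],
      (∀ ⦃T : SchemeOver (geomResidueField w)⦄ (x : T ⟶ (sch₀Of 𝓜 w I.univ xbar).X),
        (∃ z : T ⟶ Z, z ≫ ζ = x) ↔ (∀ r ∈ w.asIdeal, x ≫ (act₀Of 𝓜 w I.univ I.act r xbar).hom.hom.hom = 1) ∧ x ≫ qbar = 1) →
      Module.finrank (geomResidueField w) (Alg Z) = I.pChar ^ I.fDeg) := by
  have hq0 : I.pChar ^ I.fDeg ≠ 0 := pow_ne_zero _ I.hpChar.1.ne_zero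
  -- `Ker q̄`: finite over `κ̄`, affine, `Γ` finite
  haveI : IsFinite qbar.left := hfin
  haveI : IsFinite (ker qbar).hom := AbelianSchemeOver.isFinite_ker_hom_of_isFinite qbar
  haveI : IsAffine (ker qbar).left := isAffine_of_isAffineHom (ker qbar).hom
  haveI : Module.Finite (geomResidueField w) (Alg (ker qbar)) :=
    Module.finite_of_finrank_pos (by rw [hrkK]; exact Nat.pos_of_ne_zero (mul_ne_zero hq0 hq0))
  -- ★ K6 RE-HOME SPEED EDIT (LA3-p03 (g7) 2026-09-02, LEAD «M-142b» (2); statement bytes unchanged): ONE SYNTACTIC FORM OF THE SPECIAL FIBRE, as in §2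
  -- `hrkN_sch₀Of` — the readings used by the ★ squeeze are read through the ★ `rfl`-lemmas once (`dsimp only`; COPIES of `hr4`∕`hkerq`, the originals feed
  -- §2 in their own spelling), the plumbing runs on the raw base-changed action `ρx̄.i` (★ `RingAction.baseChange`), no coercion across the two spellings.
  have hr4' := hr4
  have hkerq' := hkerq
  dsimp only [act₀Of, AbelianSchemeOver.fibreHom_hom_hom_hom, AbelianScheme.toAbelianVariety_X, AbelianScheme.toAbelianVariety_grpObj,
    AbelianSchemeOver.fibre, AbelianSchemeOver.toAffine_X, AbelianSchemeOver.toAffine_grpObj] at hr4' hkerq' hVcw hVw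
  let ρx := (I.act.baseChange (pullback.fst (𝓜.localise w).total.hom (specResidueField w))).baseChange xbar.left
  haveI hmon : ∀ a : 𝓞 F, IsMonHom (ρx.i a) := ρx.isMonHom
  -- `Ker q̄` is `ι`-stable (weak (r4₀-q)); the restricted action along `ι_{Ker q̄}`
  have hstab : ∀ (a : 𝓞 F) ⦃T : SchemeOver (geomResidueField w)⦄ (x : T ⟶ (sch₀Of 𝓜 w I.univ xbar).X), x ≫ qbar = 1 →
      (x ≫ ρx.i a) ≫ qbar = 1 := fun a T x hx => comp_comp_eq_one_of_exists_comp_eq ρx.i qbar (hr4' a) x hx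
  haveI : ∀ a : 𝓞 F, IsMonHom (kerLift (f := qbar) (kerι qbar ≫ ρx.i a) (hstab a (kerι qbar) (kerι_comp qbar))) :=
    fun a => isMonHom_kerLift _ _
  -- `𝔭_{c•w} + 𝔭_w = (1)` and `𝔭_{c•w} 𝔭_w` kills `Ker q̄`
  have hcop : ((IsCMField.complexConj F) • w).asIdeal ⊔ w.asIdeal = ⊤ :=
    Ideal.IsMaximal.coprime_of_ne ((IsCMField.complexConj F) • w).isMaximal w.isMaximal fun h => hw (HeightOneSpectrum.ext h)
  have hkq : ∀ ⦃T : SchemeOver (geomResidueField w)⦄ (x : T ⟶ (sch₀Of 𝓜 w I.univ xbar).X), x ≫ qbar = 1 →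
      ∀ c ∈ ((IsCMField.complexConj F) • w).asIdeal * w.asIdeal, x ≫ ρx.i c = 1 :=
    fun T x hx c hc => hkerq' x hx c (by rwa [mul_comm] at hc)
  haveI := hνcw
  haveI := hνw
  -- ★ p850561 on the `c•w` side (ONE call, on the raw action); the `w` side is then §2 `hrkN_sch₀Of` fed with it
  have hsq := fun {Z : SchemeOver (geomResidueField w)} (ζ : Z ⟶ (sch₀Of 𝓜 w I.univ xbar).X) [Mono ζ] =>
    finrank_alg_eq_of_squeeze ρx.i qbar (fun a => kerLift (kerι qbar ≫ ρx.i a) (hstab a (kerι qbar) (kerι_comp qbar)))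
      (fun a => kerLift_ι _ _) ρx.i_one ρx.i_add ρx.i_mul hcop hkq hrkK νcw hVcw hqcw νw hVw hqw ζ
  have hcw : ∀ {Z' : SchemeOver (geomResidueField w)} (ζ' : Z' ⟶ (sch₀Of 𝓜 w I.univ xbar).X) [Mono ζ'],
      (∀ ⦃T : SchemeOver (geomResidueField w)⦄ (x : T ⟶ (sch₀Of 𝓜 w I.univ xbar).X),
        (∃ z : T ⟶ Z', z ≫ ζ' = x) ↔
          (∀ r ∈ ((IsCMField.complexConj F) • w).asIdeal, x ≫ (act₀Of 𝓜 w I.univ I.act r xbar).hom.hom.hom = 1) ∧ x ≫ qbar = 1) →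
      Module.finrank (geomResidueField w) (Alg Z') = I.pChar ^ I.fDeg := by
    intro Z' ζ' _ hζ'
    dsimp only [act₀Of, AbelianSchemeOver.fibreHom_hom_hom_hom, AbelianScheme.toAbelianVariety_X, AbelianScheme.toAbelianVariety_grpObj,
      AbelianSchemeOver.fibre, AbelianSchemeOver.toAffine_X, AbelianSchemeOver.toAffine_grpObj] at hζ'
    exact hsq ζ' hζ'
  exact ⟨hcw, hrkN_sch₀Of I xbar qbar hr4 hkerq hfin hrkK hcw⟩


/-! (★ re-home, size lint: PART 1 of 2 ends here at tree line :382; the workfile continues, in the same namespace, in `Theorems/F0P6aRoofWCounts.lean`.) -/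

end Squeeze
end Summit.HodgeConjecture.HodgeConjecture.Cruxes.HLiu418.F0P6aRoofWCounts
end
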